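/-
Origin: expansion seat `planner-pub-hodgecm-pv10-0`, handover #19 2026-08-18T05:00:09Z (`HOME/pub-hodgecm-pv10/lean/Pv10/FiniteAdeleLocallyCompact.lean`, md5 f5865dec, 105 lines);
landed by the gen-6 packager in gate run 22 as `HodgeCM/PerL34/FiniteAdeleLocallyCompact.lean` (import ^import Pv[0-9]+\.→import HodgeCM.PerL34. ×1).
-/
/-
# Local compactness of `𝔸_{K,f}` and `C_K` from finiteness of the residue fields (kernel reduction)

WIP module `Pv10.FiniteAdeleLocallyCompact` (pub-hodgecm-pv10); intended landing
`HodgeCM/PerL34/FiniteAdeleLocallyCompact.lean`.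

`IdeleTopology.lean` isolated the INFRASTRUCTURE target `FiniteAdeleRingLocallyCompact K` (the finite
adele ring of a number field is locally compact) as the input making `C_K` locally compact / compactly
coherent — the second instance hypothesis of `ProperCriterion.isProperMap_of_comp_factor` at `C := C_L`
(N15, PerL v5 tex ll. 310–311).  Here it is REDUCED, in the kernel, to the single textbook atom

  `ResidueFieldsFinite K : ∀ v ∤ ∞, the residue field of K_v is finite`

(Neukirch, *Algebraic Number Theory* II §5: "The valuation on such a completion is discrete and has a
finite residue class field", (5.1) "A local field is locally compact. Its valuation ring is compact",
PDF p. 127 [corpus:book:bynd-algebraic-number-theory p.127]; Cassels–Fröhlich Ch. II §14, PDF p. 114),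
which the Mathlib pin does not provide for `adicCompletion`.  Chain (all Mathlib): finite residue field +
complete + DVR ⇒ `𝒪_v` compact (`Valued.integer.compactSpace_iff_…`) ⇒ `K_v` proper hence locally compact
⇒ restricted product locally compact ⇒ `𝔸_K`, `𝔸_Kˣ`, `C_K` locally compact, `C_K` compactly coherent.
No PerL/QW8/2001 statement is used.
-/
import Summits.HodgeConjecture.HodgeCM.PerL34.IdeleTopology
import Mathlib.Topology.Algebra.Valued.LocallyCompact
import Mathlib.NumberTheory.NumberField.Completion.FinitePlace

/-! PORT of `HodgeCM/PerL34/FiniteAdeleLocallyCompact.lean` (HodgeCMPerL run 82) — verbatim mechanical port; provenance in the PORT header line. -/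

set_option autoImplicit false

noncomputable section

open Topology Set

namespace NumberField

open IsDedekindDomain
open scoped RestrictedProduct Valued

variable (K : Type*) [Field K] [NumberField K]

/-- PRINT/INFRA atom: every non-archimedean completion of `K` has finite residue field
(Neukirch II §5, (5.1)–(5.2), PDF pp. 127–128). -/
def ResidueFieldsFinite : Prop :=
  ∀ v : HeightOneSpectrum (𝓞 K), Finite 𝓀[v.adicCompletion K]

/-- `𝒪_v` is complete (closed in the complete field `K_v`). -/
instance completeSpace_integer_adicCompletion (v : HeightOneSpectrum (𝓞 K)) :
    CompleteSpace 𝒪[v.adicCompletion K] :=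
  (Valued.isClosed_integer (v.adicCompletion K)).completeSpace_coe

/-- `𝒪_v` is a DVR (Mathlib, transported to the `Valued.integer` spelling). -/
instance isDiscreteValuationRing_integer_adicCompletion (v : HeightOneSpectrum (𝓞 K)) :
    IsDiscreteValuationRing 𝒪[v.adicCompletion K] :=
  inferInstanceAs (IsDiscreteValuationRing (v.adicCompletionIntegers K))

/-- Finite residue field ⇒ `𝒪_v` compact (Neukirch II (5.1), via Mathlib's characterisation). -/
theorem compactSpace_adicCompletionIntegers (v : HeightOneSpectrum (𝓞 K))
    (h : Finite 𝓀[v.adicCompletion K]) : CompactSpace (v.adicCompletionIntegers K) :=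
  (Valued.integer.compactSpace_iff_completeSpace_and_isDiscreteValuationRing_and_finite_residueField.mpr
    ⟨inferInstance, inferInstance, h⟩ : CompactSpace 𝒪[v.adicCompletion K])

/-- Finite residue field ⇒ `K_v` is a proper metric space, hence locally compact. -/
theorem properSpace_adicCompletion (v : HeightOneSpectrum (𝓞 K))
    (h : Finite 𝓀[v.adicCompletion K]) : ProperSpace (v.adicCompletion K) :=
  Valued.integer.properSpace_iff_compactSpace_integer.mpr (compactSpace_adicCompletionIntegers K v h)

/-- (Ported verbatim from the HodgeCMPerL package; no docstring in the source.) -/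
theorem locallyCompactSpace_adicCompletion (v : HeightOneSpectrum (𝓞 K))
    (h : Finite 𝓀[v.adicCompletion K]) : LocallyCompactSpace (v.adicCompletion K) := by
  haveI := properSpace_adicCompletion K v h
  infer_instance

/-- **Finite residue fields ⇒ the finite adele ring is locally compact** (the INFRA target of
`IdeleTopology.lean`, reduced to its atom). -/
theorem finiteAdeleRingLocallyCompact_of_residueFieldsFinite (h : ResidueFieldsFinite K) :
    FiniteAdeleRingLocallyCompact K := by
  haveI : Fact (∀ v : HeightOneSpectrum (𝓞 K),
      IsOpen (v.adicCompletionIntegers K : Set (v.adicCompletion K))) :=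
    ⟨fun _ => Valued.isOpen_valuationSubring _⟩
  haveI : ∀ v : HeightOneSpectrum (𝓞 K), CompactSpace (v.adicCompletionIntegers K) :=
    fun v => compactSpace_adicCompletionIntegers K v (h v)
  haveI : ∀ v : HeightOneSpectrum (𝓞 K), WeaklyLocallyCompactSpace (v.adicCompletion K) :=
    fun v => by haveI := locallyCompactSpace_adicCompletion K v (h v); infer_instance
  haveI : WeaklyLocallyCompactSpace (FiniteAdeleRing (𝓞 K) K) := inferInstanceAs
    (WeaklyLocallyCompactSpace
      (Πʳ v : HeightOneSpectrum (𝓞 K), [v.adicCompletion K, v.adicCompletionIntegers K]))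
  show LocallyCompactSpace (FiniteAdeleRing (𝓞 K) K)
  infer_instance

/-- Hence `𝔸_Kˣ` is locally compact … -/
theorem locallyCompactSpace_ideleGroup_of_residueFieldsFinite (h : ResidueFieldsFinite K) :
    LocallyCompactSpace (ideleGroup K) :=
  locallyCompactSpace_ideleGroup K (finiteAdeleRingLocallyCompact_of_residueFieldsFinite K h)

/-- … and `C_K` is locally compact … -/
theorem locallyCompactSpace_ideleClassGroup_of_residueFieldsFinite (h : ResidueFieldsFinite K) :
    LocallyCompactSpace (IdeleClassGroup K) :=
  locallyCompactSpace_ideleClassGroup K (finiteAdeleRingLocallyCompact_of_residueFieldsFinite K h)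

/-- … and compactly coherent (the instance `isProperMap_of_comp_factor` / `isProperMap_iff_isCompact_preimage`
ask for). -/
theorem compactlyCoherentSpace_ideleClassGroup_of_residueFieldsFinite (h : ResidueFieldsFinite K) :
    CompactlyCoherentSpace (IdeleClassGroup K) :=
  compactlyCoherentSpace_ideleClassGroup K (finiteAdeleRingLocallyCompact_of_residueFieldsFinite K h)

end NumberField

end
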